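import Literature.NumberTheory.EllipticCurves.NonvanishingTwistsPrescribedLocalComponents
import Literature.NumberTheory.EllipticCurves.NonvanishingTwistsPrescribedInert
import Literature.NumberTheory.EllipticCurves.QuadraticTwistKroneckerRootNumberProofs
import Literature.NumberTheory.EllipticCurves.QuadraticTwistKroneckerEvenRootNumberProofs
import Literature.NumberTheory.EllipticCurves.CaiShuTian2014.HeegnerConditionProofs
import Literature.NumberTheory.QuadraticFields.ImaginaryQuadraticPrescribedSplittingInert
import Literature.NumberTheory.QuadraticFields.JacobiCharacter
import Literature.NumberTheory.QuadraticFields.FundamentalDiscriminant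
import HarnessLib

/-!
# The prescribed-INERT special cases of Friedberg–Hoffstein's Theorem B are consequences of the
# general class statement `𝒟(ξ; S₀)` and the Modularity Theorem

`NonvanishingTwistsPrescribedInert.lean` types FOUR special cases of Friedberg–Hoffstein, Ann. of
Math. 142 (1995), Thm. B, as cite-only named facts (`def … : Prop`): for `W/ℚ` elliptic of root
number `−1`, a finite set `S` of multiplicative primes of even cardinality (and, in the Cartan
variants, a finite set `C` of additive primes of conductor exponent two), there are imaginary
quadratic fields `K` of arbitrarily large discriminant with every prime of `S` (`∪ C`) INERT, every
other prime of the conductor SPLIT (plus prescribed splitting of an auxiliary modulus `M`, resp. of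
`2` when `2 ∤ N_W`), and `L(W^{(d_K)}, 1) ≠ 0`. In each docstring the reduction to Thm. B is the
printed argument of Jetchev–Skinner–Wan, Camb. J. Math. 5 (2017) §7.4.2, p. 31: "the root number of
the quadratic twist `E^{D″}` is `+1` and the result of Friedberg and Hoffstein ensures that `𝒦″` can
be chosen so that (d) also holds" — i.e. (1) an imaginary quadratic field with the prescribed
(unramified) local behaviour EXISTS (Dirichlet + CRT), (2) on that class the root number of the
twist is `w(W^{(d)}) = χ_d(−N_W)·w(W) = (−1)^{#S+1}·w(W) = +1`, (3) Thm. B on the class of quadratic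
characters with these local components.

Since 2026-08-30 the tree holds the GENERAL rendering of Thm. B on a class with prescribed local
components, `friedbergHoffstein_exists_twist_prescribedLocalComponents`
(`NonvanishingTwistsPrescribedLocalComponents.lean`: seed field `K₀`, `S₀ ⊇ {ℓ ∣ N_W}`, local
agreement `d_K d_{K₀} ∈ ℚ_ℓ^{×2}`, both signs), and PROVES from the Modularity Theorem
`exists_isNewformOf` the root number of a quadratic twist by a fundamental discriminant prime to the
conductor (`WeierstrassCurve.rootNumber_quadraticTwist_of_emod_four_eq_one`,
`WeierstrassCurve.rootNumber_quadraticTwist_of_four_dvd`; Murty–Murty 1997, Ch. 6 §1). This file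
carries out steps (1)–(3) in the kernel and PROVES the four special cases from these two named facts:

* §1 transfer of the local type of a quadratic field along `d·d₀ ∈ ℚ_ℓ^{×2}` (unramified odd `ℓ`:
  `(d/ℓ) = (d₀/ℓ)`; `ℓ = 2`: `d ≡ d₀ (mod 8)` for odd `d₀`) — re-proved here, the sibling's
  versions being private;
* §2 the value of the Kronecker character of an unramified class at the conductor:
  `(N / |d|) = (−1)^{Σ_{ℓ ∈ S} v_ℓ(N)}` when the primes of `S` are inert and the other primes of
  `N` split (`Nat.recOnMul` over `N`, quadratic reciprocity in the tree's form
  `Quadratic.jacobiSym_natAbs_eq_of_emod_four_eq_one`, the supplement at `2`);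
* §3 **the root number of the twist by an imaginary quadratic field unramified at the conductor**:
  `w(W^{(d_K)}) = −(−1)^{Σ_{ℓ ∈ S} v_ℓ(N_W)}·w(W)` (`S` = the inert primes), from
  `exists_isNewformOf`; in particular `= +1` when `w(W) = −1`, the primes of `S` are multiplicative
  (`v_ℓ(N_W) = 1`, `WeierstrassCurve.factorization_conductorNorm_eq_one_of_hasMultiplicativeReductionAtPrime`),
  those of `C` have `v_q(N_W) = 2`, and `#S` is even — the displayed sign computation of the four
  docstrings;
* §4 the derivations
  `friedbergHoffstein_exists_twist_ne_zero_inertAt_splitAt_of_prescribedLocalComponents`,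
  `…_inertAt_of_…`, `…_inertAt_sq_splitTwo_of_…`, `…_inertAt_sq_of_…`: seed by
  `Quadratic.exists_imaginaryQuadratic_split_inert`, sign by §3, Thm. B on
  `S₀ = {ℓ ∣ N_W} ∪ {ℓ ∣ M} ∪ S` (resp. `∪ {2} ∪ S ∪ C`), transfer by §1 and the decomposition law
  (`Quadratic.ncard_primesOver_eq_two_iff_jacobiSym`, `…_two_eq_two_iff`,
  `…_eq_one_of_jacobiSym_eq_neg_one`, `…_two_eq_one_of_discr_mod_eight`).

Everything here is PROVED; no definition and no named fact is introduced (D-0026). Consumers holding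
`friedbergHoffstein_exists_twist_prescribedLocalComponents` and `exists_isNewformOf` (e.g. the BSD
cell's PRINT conjunctions) obtain the four special cases by name.

## References

* [FriedbergHoffstein1995] S. Friedberg, J. Hoffstein, Ann. of Math. 142 (1995) 385–423, Thm. B
  (text not held, acq-00930 cite-only; statement via Zbl 0847.11026 and Diaconu–Tian 2005 §2.2).
* [JetchevSkinnerWan2017] D. Jetchev, C. Skinner, X. Wan, Camb. J. Math. 5 (2017), §7.4.2 (p. 31)
  and §4.1 (p. 17) — the printed reduction (field, sign, Thm. B).
* [MurtyMurty1997] M. R. Murty, V. K. Murty, *Non-vanishing of `L`-functions and applications*,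
  Ch. 6 §1 — `w(E^{(D)}) = χ_D(−N) w(E)` for `(D, N) = 1`.
* [Marcus2018] D. A. Marcus, *Number Fields*, Ch. 3 Thm. 25 — decomposition law.
* [Serre1973CourseArithmetic] J.-P. Serre, *A Course in Arithmetic*, Ch. II §3.3 — squares in `ℚ_ℓ^×`.
-/

noncomputable section

open scoped Classical NumberTheorySymbols

open WeierstrassCurve NumberField

namespace Literature.NumberTheory.EllipticCurves

/-! ### §1 Transfer of the local type along `d·d₀ ∈ ℚ_ℓ^{×2}` -/

/-- Odd `ℓ` unramified in `K₀ = ℚ(√d₀)` (`ℓ ∤ d₀`) and `d d₀ ∈ ℚ_ℓ^{×2}` with `ℓ² ∤ d`: then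
`ℓ ∤ d` and `(d/ℓ) = (d₀/ℓ)` — `K = ℚ(√d)` has the same (unramified) type at `ℓ` as `K₀`
(Serre, *Cours d'arithmétique* II §3.3 Thm. 3; re-proof of the sibling's private lemma).
[cite: Serre1973CourseArithmetic, Ch. II §3.3, Thm. 3 (p. 18)] -/
theorem not_dvd_and_jacobiSym_eq_of_isLocalSquare_mul {ℓ : ℕ} (hℓ : ℓ.Prime) (hℓ2 : ℓ ≠ 2)
    {d d₀ : ℤ} (hsq : ¬ (ℓ : ℤ) ^ 2 ∣ d) (hd₀ : ¬ (ℓ : ℤ) ∣ d₀) (h : IsLocalSquare ℓ (d * d₀)) :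
    ¬ (ℓ : ℤ) ∣ d ∧ jacobiSym d ℓ = jacobiSym d₀ ℓ := by
  obtain ⟨k, u, hn, hu, hj⟩ := (isLocalSquare_iff_of_ne_two hℓ2 _).mp h
  have hℓp : Prime (ℓ : ℤ) := Nat.prime_iff_prime_int.mp hℓ
  rcases k with _ | k
  · simp only [mul_zero, pow_zero, one_mul] at hn
    have hℓd : ¬ (ℓ : ℤ) ∣ d := fun h' ↦ hu (hn ▸ h'.mul_right d₀)
    refine ⟨hℓd, ?_⟩
    have hprod : jacobiSym d ℓ * jacobiSym d₀ ℓ = 1 := by rw [← jacobiSym.mul_left, hn]; exact hj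
    have hg : Int.gcd d₀ ℓ = 1 :=
      Int.isCoprime_iff_gcd_eq_one.mp (hℓp.coprime_iff_not_dvd.mpr hd₀).symm
    rcases jacobiSym.eq_one_or_neg_one hg with h1 | h1 <;> rw [h1] at hprod ⊢ <;> linarith
  · exfalso
    apply hsq
    have h2 : (ℓ : ℤ) ^ 2 ∣ d * d₀ :=
      ⟨(ℓ : ℤ) ^ (2 * k) * u, by rw [hn]; ring⟩
    exact ((hℓp.coprime_iff_not_dvd.mpr hd₀).pow_left).dvd_of_dvd_mul_right h2

/-- `2` unramified in `K₀ = ℚ(√d₀)` (`d₀ ≡ 1, 5 (mod 8)`) and `d d₀ ∈ ℚ_2^{×2}` for a field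
discriminant `d` (`d ≡ 0, 1 (mod 4)`, `d/4 ≡ 2, 3 (mod 4)` when `4 ∣ d`): then `d ≡ d₀ (mod 8)` —
`K = ℚ(√d)` has the same type at `2` as `K₀` (split iff `≡ 1`, inert iff `≡ 5 (mod 8)`;
Serre II §3.3 Thm. 4). [cite: Serre1973CourseArithmetic, Ch. II §3.3, Thm. 4 (p. 18)] -/
theorem emod_eight_eq_of_isLocalSquare_two_mul {d d₀ : ℤ}
    (hd4 : d % 4 = 0 ∨ d % 4 = 1) (hd16 : 4 ∣ d → d / 4 % 4 = 2 ∨ d / 4 % 4 = 3)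
    (hd₀ : d₀ % 8 = 1 ∨ d₀ % 8 = 5) (h : IsLocalSquare 2 (d * d₀)) : d % 8 = d₀ % 8 := by
  obtain ⟨k, u, hn, hu, hu8⟩ := (isLocalSquare_two_iff _).mp h
  rcases k with _ | k
  · simp only [mul_zero, pow_zero, one_mul] at hn
    have h1 : d * d₀ % 8 = 1 := by rw [hn]; exact hu8
    rw [Int.mul_emod] at h1
    rcases hd₀ with h₀ | h₀ <;> rw [h₀] at h1 ⊢ <;> omega
  · exfalso
    -- `4 ∣ 2^{2k+2} u = d d₀` and `d₀` odd, so `2 ∣ d`, hence `4 ∣ d`, `d = 4 f`, `f ≡ 2, 3 (mod 4)`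
    have h2dvd : (2 : ℤ) ∣ d * d₀ :=
      ⟨(2 : ℤ) ^ (2 * k + 1) * u, by rw [hn]; ring⟩
    have hd2 : (2 : ℤ) ∣ d := by
      rcases Int.prime_two.dvd_or_dvd h2dvd with h2 | h2
      · exact h2
      · exfalso; omega
    have hd40 : d % 4 = 0 := by omega
    obtain ⟨f, rfl⟩ : (4 : ℤ) ∣ d := Int.dvd_of_emod_eq_zero hd40
    have hf : f % 4 = 2 ∨ f % 4 = 3 := by
      have := hd16 (dvd_mul_right 4 f)
      rwa [Int.mul_ediv_cancel_left _ (by norm_num : (4 : ℤ) ≠ 0)] at this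
    have h1 : f * d₀ = (2 : ℤ) ^ (2 * k) * u := by
      have : (4 : ℤ) * (f * d₀) = 4 * ((2 : ℤ) ^ (2 * k) * u) := by
        rw [← mul_assoc, hn]; ring
      exact mul_left_cancel₀ (by norm_num) this
    rcases k with _ | k
    · simp only [mul_zero, pow_zero, one_mul] at h1
      have h8 : f * d₀ % 8 = 1 := by rw [h1]; exact hu8
      rw [Int.mul_emod] at h8
      rcases hd₀ with h₀ | h₀ <;> rw [h₀] at h8 <;> omega
    · have h4 : (f * d₀) % 4 = 0 := by
        rw [h1, show (2 : ℤ) ^ (2 * (k + 1)) * u = 4 * (2 ^ (2 * k) * u) by ring]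
        exact Int.mul_emod_right _ _
      rw [Int.mul_emod, show d₀ % 4 = 1 by omega] at h4
      omega

/-! ### §2 The Kronecker character of an unramified class at the conductor -/

/-- **`(N / |d|) = (−1)^{Σ_{ℓ ∈ S} v_ℓ(N)}` for `d ≡ 1 (mod 4)`** when every prime `ℓ ∣ N` in `S`
is INERT for `d` (`(d/ℓ) = −1`, resp. `d ≡ 5 (mod 8)` at `ℓ = 2`) and every prime `ℓ ∣ N` outside
`S` is SPLIT (`(d/ℓ) = +1`, resp. `d ≡ 1 (mod 8)`): the value at `N = ∏ ℓ^{v_ℓ(N)}` of the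
Kronecker character `χ_d = (· / |d|)`, prime by prime through quadratic reciprocity
`(ℓ / |d|) = (d / ℓ)` (`d ≡ 1 (mod 4)`, odd `ℓ`) and the supplement `(2 / |d|) = ±1` iff
`d ≡ 1, 5 (mod 8)` (Cox, *Primes of the form x² + ny²*, §1.C Lemma 1.14: the character
`χ = (D/·)` on `(ℤ/Dℤ)^*`, multiplicative, `χ([p]) = (D/p)` at odd primes).
[cite: Cox2013, §1.C Lemma 1.14 (the homomorphism χ with χ([p]) = (D/p))] -/
theorem jacobiSym_natCast_natAbs_eq_neg_one_pow_sum {d : ℤ} (hd : d % 4 = 1) (S : Finset ℕ)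
    {N : ℕ} (hN : N ≠ 0)
    (h : ∀ p : ℕ, p.Prime → p ∣ N →
      (p ∈ S → (p = 2 → d % 8 = 5) ∧ (p ≠ 2 → jacobiSym d p = -1)) ∧
      (p ∉ S → (p = 2 → d % 8 = 1) ∧ (p ≠ 2 → jacobiSym d p = 1))) :
    jacobiSym (N : ℤ) d.natAbs = (-1) ^ (∑ p ∈ S, N.factorization p) := by
  induction N using Nat.recOnMul with
  | zero => exact absurd rfl hN
  | one => simp [jacobiSym.one_left]
  | prime p hp =>
    have hsum : ∑ q ∈ S, p.factorization q = if p ∈ S then 1 else 0 := by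
      rw [hp.factorization]
      simp only [Finsupp.single_apply]
      rw [Finset.sum_ite_eq]
    rw [hsum]
    obtain ⟨hin, hout⟩ := h p hp dvd_rfl
    by_cases hpS : p ∈ S
    · rw [if_pos hpS, pow_one]
      by_cases hp2 : p = 2
      · subst hp2
        exact (QuadraticFields.jacobiSym_two_natAbs_eq_neg_one_iff hd).mpr ((hin hpS).1 rfl)
      · rw [QuadraticFields.jacobiSym_natAbs_eq_of_emod_four_eq_one hd (hp.odd_of_ne_two hp2)]
        exact (hin hpS).2 hp2
    · rw [if_neg hpS, pow_zero]
      by_cases hp2 : p = 2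
      · subst hp2
        exact (QuadraticFields.jacobiSym_two_natAbs_eq_one_iff hd).mpr ((hout hpS).1 rfl)
      · rw [QuadraticFields.jacobiSym_natAbs_eq_of_emod_four_eq_one hd (hp.odd_of_ne_two hp2)]
        exact (hout hpS).2 hp2
  | mul a b iha ihb =>
    have ha : a ≠ 0 := fun h0 ↦ hN (by rw [h0, zero_mul])
    have hb : b ≠ 0 := fun h0 ↦ hN (by rw [h0, mul_zero])
    rw [Nat.cast_mul, jacobiSym.mul_left,
      iha ha (fun p hp hpa ↦ h p hp (hpa.mul_right b)),
      ihb hb (fun p hp hpb ↦ h p hp (hpb.mul_left a)),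
      Nat.factorization_mul ha hb]
    simp only [Finsupp.coe_add, Pi.add_apply]
    rw [Finset.sum_add_distrib, pow_add]

/-- **`(d / N) = (−1)^{Σ_{ℓ ∈ S} v_ℓ(N)}` for odd `N`** when every prime `ℓ ∣ N` in `S` has
`(d/ℓ) = −1` and every prime `ℓ ∣ N` outside `S` has `(d/ℓ) = +1` (the Jacobi symbol prime by
prime — Ireland–Rosen, Prop. 5.2.2 (multiplicativity of the Jacobi symbol in the
denominator); used for an even discriminant `d`, where the conductor is odd).
[cite: IrelandRosen1990, Ch. 5 §2 Prop. 5.2.2 (Jacobi symbol, multiplicativity)] -/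
theorem jacobiSym_natCast_right_eq_neg_one_pow_sum (d : ℤ) (S : Finset ℕ) {N : ℕ} (hN : N ≠ 0)
    (h : ∀ p : ℕ, p.Prime → p ∣ N →
      (p ∈ S → jacobiSym d p = -1) ∧ (p ∉ S → jacobiSym d p = 1)) :
    jacobiSym d N = (-1) ^ (∑ p ∈ S, N.factorization p) := by
  induction N using Nat.recOnMul with
  | zero => exact absurd rfl hN
  | one => simp [jacobiSym.one_right]
  | prime p hp =>
    have hsum : ∑ q ∈ S, p.factorization q = if p ∈ S then 1 else 0 := by
      rw [hp.factorization]
      simp only [Finsupp.single_apply]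
      rw [Finset.sum_ite_eq]
    rw [hsum]
    obtain ⟨hin, hout⟩ := h p hp dvd_rfl
    by_cases hpS : p ∈ S
    · rw [if_pos hpS, pow_one]; exact hin hpS
    · rw [if_neg hpS, pow_zero]; exact hout hpS
  | mul a b iha ihb =>
    have ha : a ≠ 0 := fun h0 ↦ hN (by rw [h0, zero_mul])
    have hb : b ≠ 0 := fun h0 ↦ hN (by rw [h0, mul_zero])
    rw [jacobiSym.mul_right' d ha hb,
      iha ha (fun p hp hpa ↦ h p hp (hpa.mul_right b)),
      ihb hb (fun p hp hpb ↦ h p hp (hpb.mul_left a)),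
      Nat.factorization_mul ha hb]
    simp only [Finsupp.coe_add, Pi.add_apply]
    rw [Finset.sum_add_distrib, pow_add]

/-! ### §3 The root number of the twist by an imaginary quadratic field unramified at the conductor -/

section RootNumber

open Literature.NumberTheory.EllipticCurves.ModularForms Literature.NumberTheory.QuadraticFields

variable (W : WeierstrassCurve ℚ) [W.IsElliptic]

/-- The Kronecker data of a quadratic field `K` in which the primes of a finite set `S` are INERT
and the other primes of `N` SPLIT: at every prime `p ∣ N`, `(d_K/p) = −1` (resp. `d_K ≡ 5 (mod 8)`)
if `p ∈ S` and `(d_K/p) = +1` (resp. `d_K ≡ 1 (mod 8)`) otherwise — the decomposition law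
(Marcus, *Number Fields*, Ch. 3 Thm. 25) read backwards. [cite: Marcus2018, Ch. 3 Thm. 25] -/
theorem kroneckerData_of_inert_split {K : Type*} [Field K] [NumberField K]
    (h2 : Module.finrank ℚ K = 2) (S : Finset ℕ) {N : ℕ}
    (hS : ∀ ℓ ∈ S, ℓ.Prime ∧ ((Ideal.span {(ℓ : ℤ)}).primesOver (𝓞 K)).ncard = 1 ∧
      ¬ (ℓ : ℤ) ∣ NumberField.discr K)
    (hsplit : ∀ ℓ : ℕ, ℓ.Prime → ℓ ∣ N → ℓ ∉ S →
      ((Ideal.span {(ℓ : ℤ)}).primesOver (𝓞 K)).ncard = 2) :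
    ∀ p : ℕ, p.Prime → p ∣ N →
      (p ∈ S → (p = 2 → NumberField.discr K % 8 = 5) ∧ (p ≠ 2 → jacobiSym (NumberField.discr K) p = -1)) ∧
      (p ∉ S → (p = 2 → NumberField.discr K % 8 = 1) ∧ (p ≠ 2 → jacobiSym (NumberField.discr K) p = 1)) := by
  set d := NumberField.discr K with hd
  intro p hp hpN
  refine ⟨fun hpS ↦ ⟨fun hp2 ↦ ?_, fun hp2 ↦ ?_⟩, fun hpS ↦ ⟨fun hp2 ↦ ?_, fun hp2 ↦ ?_⟩⟩
  · subst hp2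
    obtain ⟨-, hone, hndvd⟩ := hS 2 hpS
    have hone' : ((Ideal.span {(2 : ℤ)}).primesOver (𝓞 K)).ncard = 1 := by exact_mod_cast hone
    have hne : ¬ d % 8 = 1 := fun h1 ↦ by
      have := (Quadratic.ncard_primesOver_two_eq_two_iff h2).mpr h1
      rw [this] at hone'
      exact absurd hone' (by decide)
    have hodd : ¬ (2 : ℤ) ∣ d := by exact_mod_cast hndvd
    rcases Quadratic.discr_emod_four (K := K) h2 with h0 | h1
    · exfalso; apply hodd; omega
    · omega
  · obtain ⟨-, hone, hndvd⟩ := hS p hpS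
    have hne : jacobiSym d p ≠ 1 := fun h1 ↦ by
      have := (Quadratic.ncard_primesOver_eq_two_iff_jacobiSym h2 hp hp2).mpr h1
      rw [this] at hone
      exact absurd hone (by decide)
    have hg : Int.gcd d p = 1 := by
      rw [Int.gcd_eq_natAbs, Int.natAbs_natCast]
      exact Nat.Coprime.symm ((Nat.Prime.coprime_iff_not_dvd hp).mpr
        (fun h' ↦ hndvd (Int.natCast_dvd.mpr h')))
    rcases jacobiSym.eq_one_or_neg_one hg with h1 | h1
    · exact absurd h1 hne
    · exact h1
  · subst hp2
    have htwo : ((Ideal.span {(2 : ℤ)}).primesOver (𝓞 K)).ncard = 2 := by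
      exact_mod_cast hsplit 2 hp hpN hpS
    exact (Quadratic.ncard_primesOver_two_eq_two_iff h2).mp htwo
  · exact (Quadratic.ncard_primesOver_eq_two_iff_jacobiSym h2 hp hp2).mp (hsplit p hp hpN hpS)

/-- An imaginary quadratic field with the primes of `S` inert and the other primes of `N` split is
UNRAMIFIED at `N`: `(d_K, N) = 1` (the decomposition law, Marcus, *Number Fields*, Ch. 3
Thm. 25: `p` ramifies iff `p ∣ d_K`; inert and split primes do not divide `d_K`).
[cite: Marcus2018, Ch. 3 Thm. 25 (decomposition law: p ramified iff p ∣ d_K)] -/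
theorem int_gcd_discr_eq_one_of_inert_split {K : Type*} [Field K] [NumberField K]
    (h2 : Module.finrank ℚ K = 2) (S : Finset ℕ) {N : ℕ}
    (hS : ∀ ℓ ∈ S, ℓ.Prime ∧ ((Ideal.span {(ℓ : ℤ)}).primesOver (𝓞 K)).ncard = 1 ∧
      ¬ (ℓ : ℤ) ∣ NumberField.discr K)
    (hsplit : ∀ ℓ : ℕ, ℓ.Prime → ℓ ∣ N → ℓ ∉ S →
      ((Ideal.span {(ℓ : ℤ)}).primesOver (𝓞 K)).ncard = 2) :
    Int.gcd (NumberField.discr K) N = 1 := by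
  set d := NumberField.discr K with hd
  have hdata := kroneckerData_of_inert_split h2 S hS hsplit
  have hcop : Nat.Coprime N d.natAbs := by
    refine Nat.coprime_of_dvd fun k hk hkN hkd ↦ ?_
    have hkd' : (k : ℤ) ∣ d := Int.natCast_dvd.mpr hkd
    by_cases hkS : k ∈ S
    · exact (hS k hkS).2.2 hkd'
    · obtain ⟨-, hout⟩ := hdata k hk hkN
      by_cases hk2 : k = 2
      · subst hk2
        have h1 := (hout hkS).1 rfl
        omega
      · have h1 := (hout hkS).2 hk2
        rw [jacobiSym.mod_left, Int.emod_eq_zero_of_dvd hkd', jacobiSym.zero_left hk.one_lt] at h1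
        exact zero_ne_one h1
  rw [Int.gcd_eq_natAbs, Int.natAbs_natCast]
  exact hcop.symm

/-- **Root number of the twist by an imaginary quadratic field unramified at the conductor, from
the Modularity Theorem**: for `W/ℚ` elliptic, `K` imaginary quadratic, `S` a finite set of primes
INERT in `K`, and every prime of `N_W` outside `S` SPLIT in `K`,
`w(W^{(d_K)}) = −(−1)^{Σ_{ℓ ∈ S} v_ℓ(N_W)} · w(W)` — i.e. `w(E ⊗ χ_d) = χ_d(−N) w(E)`
(Murty–Murty 1997, Ch. 6 §1; `(d, N) = 1`) with `χ_d(−1) = −1` and `χ_d(N) = ∏_ℓ χ_d(ℓ)^{v_ℓ(N)}`,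
`χ_d(ℓ) = −1` exactly at the inert `ℓ`. The all-split case `S = ∅` is the tree's
`rootNumber_quadraticTwist_discr_eq_neg_of_exists_isNewformOf` (`w(W^{(d_K)}) = −w(W)` under the
Heegner hypothesis); this is its unramified generalisation, by the tree's
`rootNumber_quadraticTwist_of_emod_four_eq_one` (odd `d_K`) and `rootNumber_quadraticTwist_of_four_dvd`
(`4 ∣ d_K`, then `N_W` is odd) and §2. [cite: MurtyMurty1997, Ch. 6 §1 (w(E^{(D)}) = χ_D(−N) w(E))]
[cite: JetchevSkinnerWan2017, §4.1 p. 17 (the sign under the generalised Heegner hypothesis)] -/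
theorem rootNumber_quadraticTwist_discr_of_inert_split (hmod : exists_isNewformOf)
    {K : Type*} [Field K] [NumberField K] (hK : IsImaginaryQuadratic K) (S : Finset ℕ)
    (hS : ∀ ℓ ∈ S, ℓ.Prime ∧ ((Ideal.span {(ℓ : ℤ)}).primesOver (𝓞 K)).ncard = 1 ∧
      ¬ (ℓ : ℤ) ∣ NumberField.discr K)
    (hsplit : ∀ ℓ : ℕ, ℓ.Prime → ℓ ∣ W.conductorNorm ℤ → ℓ ∉ S →
      ((Ideal.span {(ℓ : ℤ)}).primesOver (𝓞 K)).ncard = 2) :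
    (W.quadraticTwist (NumberField.discr K : ℚ)).rootNumber =
      -((-1) ^ (∑ ℓ ∈ S, (W.conductorNorm ℤ).factorization ℓ) * W.rootNumber) := by
  set N := W.conductorNorm ℤ with hN
  have hN0 : N ≠ 0 := (W.conductorNorm_pos_holds).ne'
  set d := NumberField.discr K with hd
  have h2 := hK.1
  have hdneg : d < 0 := hK.discr_neg
  have hdata := kroneckerData_of_inert_split h2 S hS hsplit
  have hgcd : Int.gcd d N = 1 := int_gcd_discr_eq_one_of_inert_split h2 S hS hsplit
  rcases Quadratic.isFundamentalDiscriminant_discr (K := K) h2 with ⟨hD4, hsq, -⟩ | ⟨h4, hm4, hsq⟩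
  · -- odd `d ≡ 1 (mod 4)`: `w' = (−1/|d|)(N/|d|) w`, `(−1/|d|) = −1`, `(N/|d|) = (−1)^Σ`
    rw [(W.rootNumber_quadraticTwist_of_emod_four_eq_one hmod hD4 hsq hgcd).1]
    have hodd : Odd d.natAbs := Int.natAbs_odd.mpr (Int.odd_iff.mpr (by omega))
    have h3 : d.natAbs % 4 = 3 := by omega
    rw [jacobiSym.at_neg_one hodd, ZMod.χ₄_nat_three_mod_four h3,
      jacobiSym_natCast_natAbs_eq_neg_one_pow_sum hD4 S hN0 hdata]
    ring
  · -- even `d = 4m`: `N` is odd, `w' = sign(d) (d/N) w = −(d/N) w`, `(d/N) = (−1)^Σ`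
    rw [(W.rootNumber_quadraticTwist_of_four_dvd hmod h4 hm4 hsq hgcd).1, if_pos hdneg]
    have hodd : ∀ p : ℕ, p.Prime → p ∣ N →
        (p ∈ S → jacobiSym d p = -1) ∧ (p ∉ S → jacobiSym d p = 1) := by
      intro p hp hpN
      obtain ⟨hin, hout⟩ := hdata p hp hpN
      have hp2 : p ≠ 2 := by
        rintro rfl
        by_cases h2S : 2 ∈ S
        · exact (hS 2 h2S).2.2 (dvd_trans (by norm_num) h4)
        · have h1 := (hout h2S).1 rfl
          omega
      exact ⟨fun hpS ↦ (hin hpS).2 hp2, fun hpS ↦ (hout hpS).2 hp2⟩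
    rw [jacobiSym_natCast_right_eq_neg_one_pow_sum d S hN0 hodd]
    ring

/-- **Sign `+1` on the Jetchev–Skinner–Wan / Kohen–Pacetti class** (the displayed computation of
`NonvanishingTwistsPrescribedInert.lean`: "`w(W^{(d_K)}) = χ_{d_K}(−N_W)·w(W) = (−1)^{#S + 1}·w(W) = +1`
when `w(W) = −1` and `#S` is even, independently of `C`" — the primes of `C` enter `N_W` squared):
for `w(W) = −1`, `S` multiplicative primes of even cardinality and `C` primes with `q² ∥ N_W`, all
inert in the imaginary quadratic `K`, and the other primes of `N_W` split, `w(W^{(d_K)}) = +1`.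
[cite: JetchevSkinnerWan2017, §7.4.2 (p. 31) and §4.1 (p. 17)]
[cite: KohenPacetti2016, Rem. 3.8 (the sign on the Cartan class)] -/
theorem rootNumber_quadraticTwist_discr_eq_one_of_inert_split (hmod : exists_isNewformOf)
    (hw : W.rootNumber = -1) (S C : Finset ℕ)
    (hSm : ∀ ℓ ∈ S, ∃ _ : Fact ℓ.Prime, W.HasMultiplicativeReductionAtPrime ℓ) (hSeven : Even S.card)
    (hC : ∀ q ∈ C, ∃ _ : Fact q.Prime, q ^ 2 ∣ W.conductorNorm ℤ ∧ ¬ q ^ 3 ∣ W.conductorNorm ℤ)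
    {K : Type*} [Field K] [NumberField K] (hK : IsImaginaryQuadratic K)
    (hin : ∀ ℓ ∈ S ∪ C, ((Ideal.span {(ℓ : ℤ)}).primesOver (𝓞 K)).ncard = 1 ∧
      ¬ (ℓ : ℤ) ∣ NumberField.discr K)
    (hsplit : ∀ ℓ : ℕ, ℓ.Prime → ℓ ∣ W.conductorNorm ℤ → ℓ ∉ S → ℓ ∉ C →
      ((Ideal.span {(ℓ : ℤ)}).primesOver (𝓞 K)).ncard = 2) :
    (W.quadraticTwist (NumberField.discr K : ℚ)).rootNumber = 1 := by
  set N := W.conductorNorm ℤ with hN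
  have hN0 : N ≠ 0 := (W.conductorNorm_pos_holds).ne'
  -- exponents: `v_ℓ(N) = 1` on `S`, `v_q(N) = 2` on `C`; hence `S ∩ C = ∅`
  have hvS : ∀ ℓ ∈ S, N.factorization ℓ = 1 := fun ℓ hℓ ↦ by
    obtain ⟨hF, hm⟩ := hSm ℓ hℓ
    exact W.factorization_conductorNorm_eq_one_of_hasMultiplicativeReductionAtPrime ℓ hm
  have hvC : ∀ q ∈ C, N.factorization q = 2 := fun q hq ↦ by
    obtain ⟨hF, h2, h3⟩ := hC q hq
    have hq := hF.out
    have hle : 2 ≤ N.factorization q := (hq.pow_dvd_iff_le_factorization hN0).mp h2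
    have hlt : ¬ 3 ≤ N.factorization q := fun h ↦ h3 ((hq.pow_dvd_iff_le_factorization hN0).mpr h)
    omega
  have hdisj : Disjoint S C := by
    rw [Finset.disjoint_left]
    intro ℓ hℓS hℓC
    have h1 := hvS ℓ hℓS
    rw [hvC ℓ hℓC] at h1
    exact absurd h1 (by decide)
  have hprime : ∀ ℓ ∈ S ∪ C, ℓ.Prime := fun ℓ hℓ ↦ by
    rcases Finset.mem_union.mp hℓ with h | h
    · obtain ⟨hF, -⟩ := hSm ℓ h; exact hF.out
    · obtain ⟨hF, -⟩ := hC ℓ h; exact hF.out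
  have hS' : ∀ ℓ ∈ S ∪ C, ℓ.Prime ∧ ((Ideal.span {(ℓ : ℤ)}).primesOver (𝓞 K)).ncard = 1 ∧
      ¬ (ℓ : ℤ) ∣ NumberField.discr K := fun ℓ hℓ ↦ ⟨hprime ℓ hℓ, hin ℓ hℓ⟩
  have hsplit' : ∀ ℓ : ℕ, ℓ.Prime → ℓ ∣ W.conductorNorm ℤ → ℓ ∉ S ∪ C →
      ((Ideal.span {(ℓ : ℤ)}).primesOver (𝓞 K)).ncard = 2 := fun ℓ hℓ hℓN hℓSC ↦
    hsplit ℓ hℓ hℓN (fun h ↦ hℓSC (Finset.mem_union_left _ h)) (fun h ↦ hℓSC (Finset.mem_union_right _ h))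
  rw [rootNumber_quadraticTwist_discr_of_inert_split W hmod hK (S ∪ C) hS' hsplit', hw,
    Finset.sum_union hdisj, Finset.sum_congr rfl hvS, Finset.sum_congr rfl hvC]
  simp only [Finset.sum_const, smul_eq_mul, mul_one]
  have hev : Even (S.card + C.card * 2) := hSeven.add (even_two.mul_left _)
  rw [hev.neg_one_pow]
  norm_num

end RootNumber

/-! ### §4 The four special cases from the class statement and the Modularity Theorem -/

section Derivations

open Literature.NumberTheory.EllipticCurves.ModularForms Literature.NumberTheory.QuadraticFields

/-- **Inert transfer**: a prime `ℓ` INERT in the quadratic field `K₀` (one prime above `ℓ`,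
`ℓ ∤ d_{K₀}`) is inert in every quadratic field `K` with `d_K d_{K₀} ∈ ℚ_ℓ^{×2}`
(§1 + the decomposition law, Marcus Ch. 3 Thm. 25). [cite: Marcus2018, Ch. 3 Thm. 25] -/
theorem inert_of_isLocalSquare_mul {K₀ K : Type*} [Field K₀] [NumberField K₀] [Field K]
    [NumberField K] (h2₀ : Module.finrank ℚ K₀ = 2) (h2 : Module.finrank ℚ K = 2) {ℓ : ℕ}
    (hℓ : ℓ.Prime) (hone₀ : ((Ideal.span {(ℓ : ℤ)}).primesOver (𝓞 K₀)).ncard = 1)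
    (hndvd₀ : ¬ (ℓ : ℤ) ∣ NumberField.discr K₀)
    (h : IsLocalSquare ℓ (NumberField.discr K * NumberField.discr K₀)) :
    ((Ideal.span {(ℓ : ℤ)}).primesOver (𝓞 K)).ncard = 1 ∧ ¬ (ℓ : ℤ) ∣ NumberField.discr K := by
  set d := NumberField.discr K with hd
  set d₀ := NumberField.discr K₀ with hd₀
  by_cases hℓ2 : ℓ = 2
  · subst hℓ2
    have hone₀' : ((Ideal.span {(2 : ℤ)}).primesOver (𝓞 K₀)).ncard = 1 := by exact_mod_cast hone₀
    have hodd₀ : ¬ (2 : ℤ) ∣ d₀ := by exact_mod_cast hndvd₀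
    have hd₀5 : d₀ % 8 = 5 := by
      have hne : ¬ d₀ % 8 = 1 := fun h1 ↦ by
        have := (Quadratic.ncard_primesOver_two_eq_two_iff h2₀).mpr h1
        rw [this] at hone₀'
        exact absurd hone₀' (by decide)
      rcases Quadratic.discr_emod_four (K := K₀) h2₀ with h0 | h1
      · exfalso; apply hodd₀; omega
      · omega
    have hd8 : d % 8 = 5 := by
      have := emod_eight_eq_of_isLocalSquare_two_mul (Quadratic.discr_emod_four h2)
        (Quadratic.discr_div_four_emod_four h2) (Or.inr hd₀5) h
      omega
    refine ⟨?_, ?_⟩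
    · exact_mod_cast Quadratic.ncard_primesOver_two_eq_one_of_discr_mod_eight h2 hd8
    · have : ¬ (2 : ℤ) ∣ d := by omega
      exact_mod_cast this
  · have hsq : ¬ (ℓ : ℤ) ^ 2 ∣ d := Quadratic.not_sq_dvd_discr_of_prime_ne_two h2 hℓ hℓ2
    obtain ⟨hnd, hj⟩ := not_dvd_and_jacobiSym_eq_of_isLocalSquare_mul hℓ hℓ2 hsq hndvd₀ h
    have hj₀ : jacobiSym d₀ ℓ = -1 := by
      have hne : jacobiSym d₀ ℓ ≠ 1 := fun h1 ↦ by
        have := (Quadratic.ncard_primesOver_eq_two_iff_jacobiSym h2₀ hℓ hℓ2).mpr h1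
        rw [this] at hone₀
        exact absurd hone₀ (by decide)
      have hg : Int.gcd d₀ ℓ = 1 := by
        rw [Int.gcd_eq_natAbs, Int.natAbs_natCast]
        exact Nat.Coprime.symm ((Nat.Prime.coprime_iff_not_dvd hℓ).mpr
          (fun h' ↦ hndvd₀ (Int.natCast_dvd.mpr h')))
      rcases jacobiSym.eq_one_or_neg_one hg with h1 | h1
      · exact absurd h1 hne
      · exact h1
    exact ⟨Quadratic.ncard_primesOver_eq_one_of_jacobiSym_eq_neg_one h2 hℓ (hj.trans hj₀), hnd⟩

/-- **Split transfer**: a prime `ℓ` SPLIT in the quadratic field `K₀` splits in every quadratic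
field `K` with `d_K d_{K₀} ∈ ℚ_ℓ^{×2}` (§1 + the decomposition law). [cite: Marcus2018, Ch. 3 Thm. 25] -/
theorem split_of_isLocalSquare_mul {K₀ K : Type*} [Field K₀] [NumberField K₀] [Field K]
    [NumberField K] (h2₀ : Module.finrank ℚ K₀ = 2) (h2 : Module.finrank ℚ K = 2) {ℓ : ℕ}
    (hℓ : ℓ.Prime) (htwo₀ : ((Ideal.span {(ℓ : ℤ)}).primesOver (𝓞 K₀)).ncard = 2)
    (h : IsLocalSquare ℓ (NumberField.discr K * NumberField.discr K₀)) :
    ((Ideal.span {(ℓ : ℤ)}).primesOver (𝓞 K)).ncard = 2 := by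
  set d := NumberField.discr K with hd
  set d₀ := NumberField.discr K₀ with hd₀
  by_cases hℓ2 : ℓ = 2
  · subst hℓ2
    have htwo₀' : ((Ideal.span {(2 : ℤ)}).primesOver (𝓞 K₀)).ncard = 2 := by exact_mod_cast htwo₀
    have hd₀1 : d₀ % 8 = 1 := (Quadratic.ncard_primesOver_two_eq_two_iff h2₀).mp htwo₀'
    have hd8 : d % 8 = 1 := by
      have := emod_eight_eq_of_isLocalSquare_two_mul (Quadratic.discr_emod_four h2)
        (Quadratic.discr_div_four_emod_four h2) (Or.inl hd₀1) h
      omega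
    exact_mod_cast (Quadratic.ncard_primesOver_two_eq_two_iff h2).mpr hd8
  · have hj₀ : jacobiSym d₀ ℓ = 1 := (Quadratic.ncard_primesOver_eq_two_iff_jacobiSym h2₀ hℓ hℓ2).mp htwo₀
    have hndvd₀ : ¬ (ℓ : ℤ) ∣ d₀ := fun hdvd ↦ by
      rw [jacobiSym.mod_left, Int.emod_eq_zero_of_dvd hdvd, jacobiSym.zero_left hℓ.one_lt] at hj₀
      exact zero_ne_one hj₀
    have hsq : ¬ (ℓ : ℤ) ^ 2 ∣ d := Quadratic.not_sq_dvd_discr_of_prime_ne_two h2 hℓ hℓ2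
    obtain ⟨-, hj⟩ := not_dvd_and_jacobiSym_eq_of_isLocalSquare_mul hℓ hℓ2 hsq hndvd₀ h
    exact (Quadratic.ncard_primesOver_eq_two_iff_jacobiSym h2 hℓ hℓ2).mpr (hj.trans hj₀)

/-- **`friedbergHoffstein_exists_twist_ne_zero_inertAt_splitAt` from Thm. B on a class and the
Modularity Theorem** (the printed reduction of Jetchev–Skinner–Wan 2017 §7.4.2, p. 31, in the
kernel): given `w(W) = −1`, `S` multiplicative primes of even cardinality and `M ≠ 0`, (1) a SEED
imaginary quadratic `K₀` with `S` inert and the primes of `N_W M` outside `S` split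
(`Quadratic.exists_imaginaryQuadratic_split_inert`), (2) `w(W^{(d_{K₀})}) = +1`
(`rootNumber_quadraticTwist_discr_eq_one_of_inert_split`), (3) Thm. B on the class of `K₀` at
`S₀ = {ℓ ∣ N_W M} ∪ S` (`friedbergHoffstein_exists_twist_prescribedLocalComponents`, alternative
(i)), (4) transfer of the local types to the produced field (`inert_of_isLocalSquare_mul`,
`split_of_isLocalSquare_mul`). [cite: FriedbergHoffstein1995, Thm. B]
[cite: JetchevSkinnerWan2017, §7.4.2 (arXiv:1512.06894 p. 31) (a)–(d) and §4.1 p. 17] -/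
theorem friedbergHoffstein_exists_twist_ne_zero_inertAt_splitAt_of_prescribedLocalComponents
    (h : friedbergHoffstein_exists_twist_prescribedLocalComponents) (hmod : exists_isNewformOf) :
    friedbergHoffstein_exists_twist_ne_zero_inertAt_splitAt := by
  intro W _ hw S hS hSeven M hM B
  set N := W.conductorNorm ℤ with hN
  have hN0 : N ≠ 0 := (W.conductorNorm_pos_holds).ne'
  have hSp : ∀ ℓ ∈ S, ℓ.Prime := fun ℓ hℓ ↦ by
    obtain ⟨hF, -⟩ := hS ℓ hℓ
    exact hF.out
  -- the split set `T = ({ℓ ∣ N} ∪ {ℓ ∣ M}) \ S`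
  set T : Finset ℕ := (N.primeFactors ∪ M.primeFactors) \ S with hT
  have hTp : ∀ p ∈ T, p.Prime := fun p hp ↦ by
    obtain ⟨hp, -⟩ := Finset.mem_sdiff.mp hp
    rcases Finset.mem_union.mp hp with h' | h'
    · exact Nat.prime_of_mem_primeFactors h'
    · exact Nat.prime_of_mem_primeFactors h'
  have hTS : Disjoint T S := Finset.sdiff_disjoint
  have hmemT : ∀ ℓ : ℕ, ℓ.Prime → (ℓ ∣ N ∨ ℓ ∣ M) → ℓ ∉ S → ℓ ∈ T := by
    intro ℓ hℓ hdvd hℓS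
    refine Finset.mem_sdiff.mpr ⟨?_, hℓS⟩
    rcases hdvd with h' | h'
    · exact Finset.mem_union_left _ (Nat.mem_primeFactors.mpr ⟨hℓ, h', hN0⟩)
    · exact Finset.mem_union_right _ (Nat.mem_primeFactors.mpr ⟨hℓ, h', hM⟩)
  -- (1) the seed field
  obtain ⟨r, K₀, iF₀, iN₀, hr, -, -, -, -, h2₀, hdisc₀, hTsplit₀, hSinert₀, -⟩ :=
    Quadratic.exists_imaginaryQuadratic_split_inert T S hTp hSp hTS 0
  have hK₀ : IsImaginaryQuadratic K₀ :=
    ⟨h2₀, Quadratic.isTotallyComplex_of_discr_neg h2₀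
      (by rw [hdisc₀, neg_lt_zero]; exact_mod_cast hr.pos)⟩
  -- (2) the sign on the class
  have hin₀ : ∀ ℓ ∈ S ∪ ∅, ((Ideal.span {(ℓ : ℤ)}).primesOver (𝓞 K₀)).ncard = 1 ∧
      ¬ (ℓ : ℤ) ∣ NumberField.discr K₀ := fun ℓ hℓ ↦ by
    rw [Finset.union_empty] at hℓ
    exact ⟨(hSinert₀ ℓ hℓ).2, (hSinert₀ ℓ hℓ).1⟩
  have hsplit₀ : ∀ ℓ : ℕ, ℓ.Prime → ℓ ∣ W.conductorNorm ℤ → ℓ ∉ S → ℓ ∉ (∅ : Finset ℕ) →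
      ((Ideal.span {(ℓ : ℤ)}).primesOver (𝓞 K₀)).ncard = 2 :=
    fun ℓ hℓ hℓN hℓS _ ↦ (hTsplit₀ ℓ (hmemT ℓ hℓ (Or.inl hℓN) hℓS)).2
  have hsign : (W.quadraticTwist (NumberField.discr K₀ : ℚ)).rootNumber = 1 :=
    rootNumber_quadraticTwist_discr_eq_one_of_inert_split W hmod hw S ∅ hS hSeven
      (fun q hq ↦ absurd hq (Finset.notMem_empty q)) hK₀ hin₀ hsplit₀
  -- (3) Thm. B on the class of `K₀` at `S₀ = T ∪ S`
  have hS₀N : ∀ ℓ : ℕ, ℓ.Prime → ℓ ∣ W.conductorNorm ℤ → ℓ ∈ T ∪ S := fun ℓ hℓ hℓN ↦ by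
    by_cases hℓS : ℓ ∈ S
    · exact Finset.mem_union_right _ hℓS
    · exact Finset.mem_union_left _ (hmemT ℓ hℓ (Or.inl hℓN) hℓS)
  obtain ⟨K, iF, iN, hK, hB, hagree, hL⟩ := (h W (T ∪ S) K₀ hK₀ hS₀N B).1 hsign
  have h2 := hK.1
  -- (4) transfer
  refine ⟨K, iF, iN, hK, hB, fun ℓ hℓS ↦ ?_, fun ℓ hℓ hℓN hℓS ↦ ?_, fun ℓ hℓ hℓM hℓS ↦ ?_, hL⟩
  · obtain ⟨hnd₀, hone₀⟩ := hSinert₀ ℓ hℓS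
    exact inert_of_isLocalSquare_mul h2₀ h2 (hSp ℓ hℓS) hone₀ hnd₀
      (hagree ℓ (Finset.mem_union_right _ hℓS) (hSp ℓ hℓS))
  · have hℓT := hmemT ℓ hℓ (Or.inl hℓN) hℓS
    exact split_of_isLocalSquare_mul h2₀ h2 hℓ (hTsplit₀ ℓ hℓT).2
      (hagree ℓ (Finset.mem_union_left _ hℓT) hℓ)
  · have hℓT := hmemT ℓ hℓ (Or.inr hℓM) hℓS
    exact split_of_isLocalSquare_mul h2₀ h2 hℓ (hTsplit₀ ℓ hℓT).2
      (hagree ℓ (Finset.mem_union_left _ hℓT) hℓ)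

/-- **`friedbergHoffstein_exists_twist_ne_zero_inertAt` from Thm. B on a class and the Modularity
Theorem**: the sibling `…_inertAt_splitAt` at `M = 1`. [cite: FriedbergHoffstein1995, Thm. B]
[cite: JetchevSkinnerWan2017, §7.4.2 (arXiv:1512.06894 p. 31) and §4.1 p. 17] -/
theorem friedbergHoffstein_exists_twist_ne_zero_inertAt_of_prescribedLocalComponents
    (h : friedbergHoffstein_exists_twist_prescribedLocalComponents) (hmod : exists_isNewformOf) :
    friedbergHoffstein_exists_twist_ne_zero_inertAt := by
  intro W _ hw S hS hSeven B
  obtain ⟨K, iF, iN, hK, hB, hin, hsplit, -, hL⟩ :=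
    friedbergHoffstein_exists_twist_ne_zero_inertAt_splitAt_of_prescribedLocalComponents h hmod W hw
      S hS hSeven 1 one_ne_zero B
  exact ⟨K, iF, iN, hK, hB, hin, hsplit, hL⟩

/-- **`friedbergHoffstein_exists_twist_ne_zero_inertAt_sq_splitTwo` from Thm. B on a class and the
Modularity Theorem** (the Cartan variant: the inert set is `S ∪ C`, `C` = primes with `q² ∥ N_W`,
which enter the sign squared; `2` is put in the split set when it is not in `S ∪ C`): seed by
`Quadratic.exists_imaginaryQuadratic_split_inert` with split set `({2} ∪ {ℓ ∣ N_W}) \ (S ∪ C)`,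
sign `+1` by `rootNumber_quadraticTwist_discr_eq_one_of_inert_split`, Thm. B at
`S₀ = {2} ∪ {ℓ ∣ N_W} ∪ S ∪ C`, transfer by §1. [cite: FriedbergHoffstein1995, Thm. B]
[cite: KohenPacetti2016, §3, Thm. 3.6 ∕ 3.7 and Rem. 3.8 (arXiv:1403.7801v3)]
[cite: JetchevSkinnerWan2017, §7.4.2 (arXiv:1512.06894 p. 31) clause (c) and §4.1 p. 17] -/
theorem friedbergHoffstein_exists_twist_ne_zero_inertAt_sq_splitTwo_of_prescribedLocalComponents
    (h : friedbergHoffstein_exists_twist_prescribedLocalComponents) (hmod : exists_isNewformOf) :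
    friedbergHoffstein_exists_twist_ne_zero_inertAt_sq_splitTwo := by
  intro W _ hw S C hS hSeven hC B
  set N := W.conductorNorm ℤ with hN
  have hN0 : N ≠ 0 := (W.conductorNorm_pos_holds).ne'
  have hSCp : ∀ ℓ ∈ S ∪ C, ℓ.Prime := fun ℓ hℓ ↦ by
    rcases Finset.mem_union.mp hℓ with h' | h'
    · obtain ⟨hF, -⟩ := hS ℓ h'; exact hF.out
    · obtain ⟨hF, -⟩ := hC ℓ h'; exact hF.out
  -- the primes of `S ∪ C` divide `N`
  have hSdvd : ∀ ℓ ∈ S, ℓ ∣ N := fun ℓ hℓ ↦ by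
    obtain ⟨hF, hm⟩ := hS ℓ hℓ
    have h1 : N.factorization ℓ = 1 :=
      W.factorization_conductorNorm_eq_one_of_hasMultiplicativeReductionAtPrime ℓ hm
    exact Nat.dvd_of_factorization_pos (by rw [h1]; exact one_ne_zero)
  have hCdvd : ∀ q ∈ C, q ∣ N := fun q hq ↦ by
    obtain ⟨-, h2, -⟩ := hC q hq
    exact (dvd_pow_self q two_ne_zero).trans h2
  -- the split set `T = ({2} ∪ {ℓ ∣ N}) \ (S ∪ C)`
  set T : Finset ℕ := (insert 2 N.primeFactors) \ (S ∪ C) with hT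
  have hTp : ∀ p ∈ T, p.Prime := fun p hp ↦ by
    obtain ⟨hp, -⟩ := Finset.mem_sdiff.mp hp
    rcases Finset.mem_insert.mp hp with rfl | h'
    · exact Nat.prime_two
    · exact Nat.prime_of_mem_primeFactors h'
  have hTS : Disjoint T (S ∪ C) := Finset.sdiff_disjoint
  have hmemT : ∀ ℓ : ℕ, ℓ.Prime → (ℓ ∣ N ∨ ℓ = 2) → ℓ ∉ S → ℓ ∉ C → ℓ ∈ T := by
    intro ℓ hℓ hdvd hℓS hℓC
    refine Finset.mem_sdiff.mpr ⟨?_, fun h' ↦ ?_⟩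
    · rcases hdvd with h' | rfl
      · exact Finset.mem_insert_of_mem (Nat.mem_primeFactors.mpr ⟨hℓ, h', hN0⟩)
      · exact Finset.mem_insert_self _ _
    · rcases Finset.mem_union.mp h' with h'' | h''
      · exact hℓS h''
      · exact hℓC h''
  -- (1) the seed field
  obtain ⟨r, K₀, iF₀, iN₀, hr, -, -, -, -, h2₀, hdisc₀, hTsplit₀, hSCinert₀, -⟩ :=
    Quadratic.exists_imaginaryQuadratic_split_inert T (S ∪ C) hTp hSCp hTS 0
  have hK₀ : IsImaginaryQuadratic K₀ :=
    ⟨h2₀, Quadratic.isTotallyComplex_of_discr_neg h2₀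
      (by rw [hdisc₀, neg_lt_zero]; exact_mod_cast hr.pos)⟩
  -- (2) the sign on the class
  have hin₀ : ∀ ℓ ∈ S ∪ C, ((Ideal.span {(ℓ : ℤ)}).primesOver (𝓞 K₀)).ncard = 1 ∧
      ¬ (ℓ : ℤ) ∣ NumberField.discr K₀ := fun ℓ hℓ ↦
    ⟨(hSCinert₀ ℓ hℓ).2, (hSCinert₀ ℓ hℓ).1⟩
  have hsplit₀ : ∀ ℓ : ℕ, ℓ.Prime → ℓ ∣ W.conductorNorm ℤ → ℓ ∉ S → ℓ ∉ C →
      ((Ideal.span {(ℓ : ℤ)}).primesOver (𝓞 K₀)).ncard = 2 :=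
    fun ℓ hℓ hℓN hℓS hℓC ↦ (hTsplit₀ ℓ (hmemT ℓ hℓ (Or.inl hℓN) hℓS hℓC)).2
  have hsign : (W.quadraticTwist (NumberField.discr K₀ : ℚ)).rootNumber = 1 :=
    rootNumber_quadraticTwist_discr_eq_one_of_inert_split W hmod hw S C hS hSeven hC hK₀ hin₀ hsplit₀
  -- (3) Thm. B on the class of `K₀` at `S₀ = T ∪ (S ∪ C)`
  have hS₀N : ∀ ℓ : ℕ, ℓ.Prime → ℓ ∣ W.conductorNorm ℤ → ℓ ∈ T ∪ (S ∪ C) := fun ℓ hℓ hℓN ↦ by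
    by_cases hℓSC : ℓ ∈ S ∪ C
    · exact Finset.mem_union_right _ hℓSC
    · exact Finset.mem_union_left _ (hmemT ℓ hℓ (Or.inl hℓN)
        (fun h' ↦ hℓSC (Finset.mem_union_left _ h')) (fun h' ↦ hℓSC (Finset.mem_union_right _ h')))
  obtain ⟨K, iF, iN, hK, hB, hagree, hL⟩ := (h W (T ∪ (S ∪ C)) K₀ hK₀ hS₀N B).1 hsign
  have h2 := hK.1
  -- (4) transfer
  refine ⟨K, iF, iN, hK, hB, fun ℓ hℓSC ↦ ?_, fun ℓ hℓ hℓN hℓS hℓC ↦ ?_, fun h2N ↦ ?_, hL⟩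
  · obtain ⟨hnd₀, hone₀⟩ := hSCinert₀ ℓ hℓSC
    exact inert_of_isLocalSquare_mul h2₀ h2 (hSCp ℓ hℓSC) hone₀ hnd₀
      (hagree ℓ (Finset.mem_union_right _ hℓSC) (hSCp ℓ hℓSC))
  · have hℓT := hmemT ℓ hℓ (Or.inl hℓN) hℓS hℓC
    exact split_of_isLocalSquare_mul h2₀ h2 hℓ (hTsplit₀ ℓ hℓT).2
      (hagree ℓ (Finset.mem_union_left _ hℓT) hℓ)
  · have h2S : 2 ∉ S := fun h' ↦ h2N (hSdvd 2 h')
    have h2C : 2 ∉ C := fun h' ↦ h2N (hCdvd 2 h')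
    have h2T := hmemT 2 Nat.prime_two (Or.inr rfl) h2S h2C
    have := split_of_isLocalSquare_mul h2₀ h2 Nat.prime_two (hTsplit₀ 2 h2T).2
      (hagree 2 (Finset.mem_union_left _ h2T) Nat.prime_two)
    exact_mod_cast this

/-- **`friedbergHoffstein_exists_twist_ne_zero_inertAt_sq` from Thm. B on a class and the
Modularity Theorem**: the sibling `…_inertAt_sq_splitTwo` with the clause at `2` dropped.
[cite: FriedbergHoffstein1995, Thm. B] [cite: KohenPacetti2016, §3, Thm. 3.6 ∕ 3.7 (arXiv:1403.7801v3)] -/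
theorem friedbergHoffstein_exists_twist_ne_zero_inertAt_sq_of_prescribedLocalComponents
    (h : friedbergHoffstein_exists_twist_prescribedLocalComponents) (hmod : exists_isNewformOf) :
    friedbergHoffstein_exists_twist_ne_zero_inertAt_sq := by
  intro W _ hw S C hS hSeven hC B
  obtain ⟨K, iF, iN, hK, hB, hin, hsplit, -, hL⟩ :=
    friedbergHoffstein_exists_twist_ne_zero_inertAt_sq_splitTwo_of_prescribedLocalComponents h hmod W
      hw S C hS hSeven hC B
  exact ⟨K, iF, iN, hK, hB, hin, hsplit, hL⟩

end Derivations

end Literature.NumberTheory.EllipticCurves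

end
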